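import Summits.Ventures.HSemireg.WedgeHankelRecurrenceSynthesis
import Summits.Ventures.HSemireg.WedgeHankelRecurrencePronyDivisors

/-!
# Venture HSemireg — CONFLUENT PRONY SYNTHESIS: **if the divisor polynomial `Π_i (X − λ_i)^{P_i+1}` (distinct nodes, `D = Σ_i (P_i + 1)`) is a recurrence of `q` of window `D + 1` on
# `[0, N]`, then `q = Σ_i expMul λ_i q_i` on `[0, N]` with `q_i` of orders `≤ P_i`** (the confluent Vandermonde system on `[0, D)` is square and injective by F2a, hence solvable; the monic
# recurrence continues uniquely, N23); the split criterion with multiplicities and the uniqueness of the `q_i` — the converse of N20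

HONEST FRAMING. Part of the Lean index of the computation cell `pub-hsemireg` (seat p10 gen 26, Sunday typer «UNIFORM-IN-n»).
LINEAR ALGEBRA OF HANKEL (catalecticant) MATRICES and of polynomials over a field ONLY: no variety, no cohomology theory, no sheaf, no Ext group and no semiregularity map is constructed
here; nothing here says that HC / HC_CM / HC_AV holds; no Literature fact is declared or used.  Custodian versions as in `WedgeHankelSiegelIdeal` (1/3); the dictionary (`Σ_i expMul λ_i q_i` =
a divisor class `Σ_i exp(λ_i Θ) v_i`, `ord v_i ≤ P_i`; the divisor `Σ_i (P_i+1)[λ_i]` on the rational normal curve) is QUOTED, never asserted.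

WHAT IS IN THE TREE.  F2a (`WedgeHankelDivisorRank`, tree): `DIdx`, `card_DIdx`, `cvMat` (the confluent node matrix), `extSeq`, **`cvMat_transpose_mulVec`** (`(cvMat c)ᵀ w` = the divisor sequence on
`[0, c)`), **`cvMat_transpose_mulVecLin_injective`** (`D ≤ c`); N23 (`WedgeHankelRecurrenceSynthesis`, № 176) `eq_of_monic_recurrence`, `recSpace_congr`, `hkFun_eq_zero_of_mem_recSpace`; N20
(`WedgeHankelRecurrencePronyDivisors`, № 181 v2) `divisorPoly_mem_recSpace`, `natDegree_divisorPoly`.  Mathlib `LinearMap.injective_iff_surjective_of_finrank_eq_finrank`.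
THIS FILE (namespace `Summit.Ventures.HSemireg.Wedge.HankelOuter` continued; PLAIN over the tree; 0 definitions):
* §502 **`exists_divisor_eq_on_lt`** (distinct nodes: every vector of `D` initial values is taken on `[0, D)` by a divisor class with orders `≤ P_i`).
* §503 **`exists_divisor_of_divisorPoly_mem_recSpace`** (CONFLUENT PRONY SYNTHESIS), **`exists_divisor_iff_divisorPoly_mem_recSpace`** (fixed distinct nodes and order bounds: `q` is SOME such
  divisor class on `[0, N]` iff the divisor polynomial is a recurrence of window `D + 1`), **`exists_divisor_iff_exists_split_recurrence`** (THE SPLIT CRITERION WITH MULTIPLICITIES; N23 is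
  `P = 0`), **`divisor_coeffs_unique`** (`D ≤ N + 1`: the `q_i` are determined on `[0, P_i]`).
READING: N20 ⟹ the minimal recurrence of a divisor class is its divisor polynomial; this file ⟸ a split recurrence (with multiplicities) synthesises the divisor class — together the
confluent Prony method as theorems about `Rec_D(q)`; with N29 (node at infinity) and N26 (non-split `m`) every line of `K[X]_{≤ r}` has its synthesis.  Nothing Ext-side.  New names only.
-/

open Module Polynomial
open scoped Matrix Polynomial

namespace Summit.Ventures.HSemireg.Wedge.HankelOuter

open Summit.Ventures.HSemireg.Wedge Summit.Ventures.HSemireg.Wedge.Hankel Summit.Ventures.HSemireg.Wedge.HankelSecant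
  Summit.Ventures.HSemireg.Wedge.HankelFrameChange

variable (K : Type*) [Field K] {N : ℕ}

/-! ## §502. The confluent Vandermonde system for the initial values is solvable -/

/-- **for distinct nodes and orders `P_i` with `D = Σ_i (P_i + 1)`, every vector of `D` initial values is taken by some divisor class `Σ_i expMul λ_i q_i` (orders `≤ P_i`) on `[0, D)`**
(F2a's confluent node matrix `cvMat λ P D` is square and injective, hence onto). -/
theorem exists_divisor_eq_on_lt {r : ℕ} {lam : Fin r → K} (hlam : Function.Injective lam) (P : Fin r → ℕ) (x : Fin (∑ i, (P i + 1)) → K) :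
    ∃ w : DIdx P → K, ∀ j : Fin (∑ i, (P i + 1)), (∑ i, expMul K (lam i) (extSeq K w i) (j : ℕ)) = x j := by
  have hinj := cvMat_transpose_mulVecLin_injective K hlam P (c := ∑ i, (P i + 1)) le_rfl
  -- square: injective ⇒ surjective
  have hsurj : Function.Surjective (cvMat K lam P (∑ i, (P i + 1)))ᵀ.mulVecLin := by
    refine (LinearMap.injective_iff_surjective_of_finrank_eq_finrank ?_).mp hinj
    rw [Module.finrank_fintype_fun_eq_card, Module.finrank_fintype_fun_eq_card, card_DIdx, Fintype.card_fin]
  obtain ⟨w, hw⟩ := hsurj x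
  refine ⟨w, fun j => ?_⟩
  rw [← cvMat_transpose_mulVec K lam P _ w j, ← Matrix.mulVecLin_apply, hw]

/-! ## §503. Confluent Prony synthesis: a recurrence `Π_i (X − λ_i)^{P_i+1}` forces the divisor class -/

/-- **CONFLUENT PRONY SYNTHESIS: if the divisor polynomial `Π_i (X − λ_i)^{P_i+1}` of distinct nodes (`D = Σ_i (P_i+1)`) is a recurrence of `q` of window `D + 1` on `[0, N]`, then
`q = Σ_i expMul λ_i q_i` on `[0, N]` for some sequences `q_i` of orders `≤ P_i`** — the unique continuation of the monic recurrence from the confluent Vandermonde solve on `[0, D)`. -/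
theorem exists_divisor_of_divisorPoly_mem_recSpace {r : ℕ} {lam : Fin r → K} (hlam : Function.Injective lam) (P : Fin r → ℕ) {q : ℕ → K}
    (hm : (∏ i, (Polynomial.X - Polynomial.C (lam i)) ^ (P i + 1)) ∈ recSpace K N q (∑ i, (P i + 1))) :
    ∃ qs : Fin r → ℕ → K, (∀ i j, P i < j → qs i j = 0) ∧ ∀ j ≤ N, q j = ∑ i, expMul K (lam i) (qs i) j := by
  obtain ⟨w, hw⟩ := exists_divisor_eq_on_lt K hlam P (fun j => q j)
  refine ⟨fun i => extSeq K w i, fun i j hj => extSeq_apply_of_lt K w i hj, ?_⟩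
  have hmonic : (∏ i, (Polynomial.X - Polynomial.C (lam i)) ^ (P i + 1)).Monic :=
    Polynomial.monic_prod_of_monic _ _ fun i _ => (Polynomial.monic_X_sub_C (lam i)).pow _
  refine eq_of_monic_recurrence K hmonic (natDegree_divisorPoly K lam P) (hkFun_eq_zero_of_mem_recSpace K hm)
    (hkFun_eq_zero_of_mem_recSpace K (divisorPoly_mem_recSpace K (N := N) lam (q := fun i => extSeq K w i) fun i j hj => extSeq_apply_of_lt K w i hj))
    fun j hj => ?_
  exact (hw ⟨j, hj⟩).symm

/-- **… and conversely** (orders `≤ P_i`, any nodes): `q` agrees on `[0, N]` with SOME divisor class on the distinct nodes `λ_i` with orders `≤ P_i` iff `Π_i (X − λ_i)^{P_i+1} ∈ Rec_D(q)`. -/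
theorem exists_divisor_iff_divisorPoly_mem_recSpace {r : ℕ} {lam : Fin r → K} (hlam : Function.Injective lam) (P : Fin r → ℕ) (q : ℕ → K) :
    (∃ qs : Fin r → ℕ → K, (∀ i j, P i < j → qs i j = 0) ∧ ∀ j ≤ N, q j = ∑ i, expMul K (lam i) (qs i) j)
      ↔ (∏ i, (Polynomial.X - Polynomial.C (lam i)) ^ (P i + 1)) ∈ recSpace K N q (∑ i, (P i + 1)) := by
  refine ⟨?_, exists_divisor_of_divisorPoly_mem_recSpace K hlam P⟩
  rintro ⟨qs, hqs, h⟩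
  rw [recSpace_congr K h]
  exact divisorPoly_mem_recSpace K lam hqs

/-- the GENERAL SPLIT CRITERION: **`q` is a divisor class on `[0, N]` with `r` distinct affine nodes of orders `≤ P_i` iff the split polynomial `Π_i (X − λ_i)^{P_i+1}` of degree `D` lies in
`Rec_D(q)` for some injective `λ`** (N23 is the square-free case `P = 0`). -/
theorem exists_divisor_iff_exists_split_recurrence {r : ℕ} (P : Fin r → ℕ) (q : ℕ → K) :
    (∃ (lam : Fin r → K) (qs : Fin r → ℕ → K), Function.Injective lam ∧ (∀ i j, P i < j → qs i j = 0) ∧ ∀ j ≤ N, q j = ∑ i, expMul K (lam i) (qs i) j)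
      ↔ ∃ lam : Fin r → K, Function.Injective lam ∧ (∏ i, (Polynomial.X - Polynomial.C (lam i)) ^ (P i + 1)) ∈ recSpace K N q (∑ i, (P i + 1)) := by
  constructor
  · rintro ⟨lam, qs, hlam, hqs, h⟩
    exact ⟨lam, hlam, (exists_divisor_iff_divisorPoly_mem_recSpace K hlam P q).mp ⟨qs, hqs, h⟩⟩
  · rintro ⟨lam, hlam, hm⟩
    obtain ⟨qs, hqs, h⟩ := exists_divisor_of_divisorPoly_mem_recSpace K hlam P hm
    exact ⟨lam, qs, hlam, hqs, h⟩

/-- uniqueness of the coefficient sequences: **two divisor classes on the same distinct nodes with orders `≤ P_i`, equal on `[0, N]` with `D ≤ N + 1`, have the same `q_i` on `[0, P_i]`**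
(F2a's confluent Vandermonde injectivity). -/
theorem divisor_coeffs_unique {r : ℕ} {lam : Fin r → K} (hlam : Function.Injective lam) {P : Fin r → ℕ} (hDN : (∑ i, (P i + 1)) ≤ N + 1) {qs qs' : Fin r → ℕ → K}
    (hqs : ∀ i j, P i < j → qs i j = 0) (hqs' : ∀ i j, P i < j → qs' i j = 0) (h : ∀ j ≤ N, (∑ i, expMul K (lam i) (qs i) j) = ∑ i, expMul K (lam i) (qs' i) j) :
    qs = qs' := by
  have hinj := cvMat_transpose_mulVecLin_injective K hlam P (c := ∑ i, (P i + 1)) le_rfl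
  -- restrict to the blocks
  set w : DIdx P → K := fun x => qs x.1 x.2 with hw
  set w' : DIdx P → K := fun x => qs' x.1 x.2 with hw'
  have hext : ∀ i, extSeq K w i = qs i := fun i => funext fun t => by
    by_cases ht : t < P i + 1
    · rw [extSeq, dif_pos ht]
    · rw [extSeq, dif_neg ht, hqs i t (by omega)]
  have hext' : ∀ i, extSeq K w' i = qs' i := fun i => funext fun t => by
    by_cases ht : t < P i + 1
    · rw [extSeq, dif_pos ht]
    · rw [extSeq, dif_neg ht, hqs' i t (by omega)]
  have hww : w = w' := hinj (by
    funext l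
    rw [Matrix.mulVecLin_apply, Matrix.mulVecLin_apply, cvMat_transpose_mulVec, cvMat_transpose_mulVec]
    simp only [hext, hext']
    exact h l (by have := l.2; omega))
  funext i t
  by_cases ht : t < P i + 1
  · have := congrFun hww ⟨i, ⟨t, ht⟩⟩
    exact this
  · rw [hqs i t (by omega), hqs' i t (by omega)]

end Summit.Ventures.HSemireg.Wedge.HankelOuter
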